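import Literature.IUT.HodgeTheaters.PMBaseIsoTorsorTwisted

/-!
# [IUTchI] Prop 6.6 (iii) from the TWISTED `[−1]`-compatibility of `φ^{Θell}_{•,v}`

S. Mochizuki, *Inter-universal Teichmüller theory I: construction of Hodge theaters*, §6, Example 6.3 (ii)
p. 161, Proposition 6.6 (iii) p. 165 of the kurims manuscript (May 2020) [claim: Mochizuki2012, status: disputed].
PROOF-ONLY companion (theorems, no definitions) of abc-iut-L5-t4's `PMBaseBridgeProps.lean` (abc-iut cell, block F
fact-proving wave, seat abc-iut-f-071 gen 4; FACT-LIST row F-2018 `IsoTorsor`, Prop 6.6 (iii)).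

abc-iut-L5-t13's `DThetaPMEllHT.isoTorsor_surjective_of_equivariant` (`PMBaseBridgePropsProofs9.lean`) builds, from
the equivariance of Example 6.3 (ii) for the negative elements of `𝔽_l^{⋊±}` (equivalently from (β) =
`Ex63.NegCompatModel K`), every isomorphism of `𝒟-Θ^{±ell}`-Hodge theaters with prescribed index bijection
`±1`.  Here the same construction is run from the WEAKER twisted `[−1]`-compatibility — a lift of `(d, −1)` for
ONE `d ∈ 𝔽_l` common to all `v` intertwined by every `φ^{Θell}_{•,v}` with a negative automorphism of `𝒟_v` —
through the two-element equivariance of `PMBaseIsoTorsorTwisted.lean` (index `γ = (0, ±1)` on `𝔇_±`, lift of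
`δ = γ · (−d, +1)` on `𝒟^{⊚±}`):

* `DThetaPMEllHT.isoTorsor_surjective_of_twistedNegCompat`, `DThetaPMEllHT.isoTorsor_of_twistedNegCompat` —
  **Prop 6.6 (iii) from the twisted form** (`d = 0` is abc-iut-L5-t13's `isoTorsor_of_negCompat`).

Nothing here takes a side on [IUTchIII] Cor. 3.12 or asserts anything about the genuine objects of [IUTchI];
typed ≠ proved; a FACT-LIST row is an assumption label, proved/refuted = OUR kernel check only.
-/

namespace Literature.IUT.HodgeTheaters

open CategoryTheory

universe u

namespace PMBaseKit

variable {l : ℕ} {K : PMBaseKit.{u} l}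

namespace DThetaPMEllHT

/-- **[IUTchI] Prop 6.6 (iii), surjectivity — from the TWISTED `[−1]`-compatibility** (p. 165): every
isomorphism of `𝔽_l^±`-groups between the index sets (`±1` in model coordinates, `exists_sign_of_compat`) is
induced by an isomorphism of `𝒟-Θ^{±ell}`-Hodge theaters.  abc-iut-L5-t13's construction
(`isoTorsor_surjective_of_equivariant`) verbatim, except that the global constituent of the `Θ^{ell}`-part is a
lift of `δ = (0, ±1) · (−d, +1)` in the negative case (two-element equivariance
`Ex63.twEquivariant_of_twistedNegCompat`, global side `ellConj_global_side_of_twEquivariant`).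
[claim: Mochizuki2012, status: disputed] -/
theorem isoTorsor_surjective_of_twistedNegCompat {d : ZMod l}
    (htw : ∀ v, ∃ a : K.model v ≅ K.model v, K.labMap v a = labNeg (K.isLocal_model v) ∧
      ∃ b ∈ Ex63.lifts K (FlPM.mk d (-1)), a.hom ≫ K.phiEll v = K.phiEll v ≫ (K.atV v).map b.hom)
    (H₁ H₂ : K.DThetaPMEllHT) :
    Function.Surjective fun g : Iso H₁ H₂ =>
      (⟨g.pmIso.indexEquiv, g.pmIso.indexEquiv_charts⟩ : {ι : H₁.T ≃ H₂.T // H₁.grpT.Compat H₂.grpT ι}) := by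
  rintro ⟨κ, hκ⟩
  obtain ⟨ι₁, hι₁, α₁, β₁, γ₁, hPM₁, hEll₁⟩ := H₁.exists_model
  obtain ⟨ι₂, hι₂, α₂, β₂, γ₂, hPM₂, hEll₂⟩ := H₂.exists_model
  obtain ⟨δ, rfl⟩ := exists_sign_of_compat H₁ H₂ hι₁ hι₂ hκ
  -- the element `γ = (0, δ)` and its (two-element) equivariance: global lifts of `δ'`
  obtain ⟨δ', hE⟩ : ∃ δ' : FlPM l, ∀ (z : ZMod l) (v : K.V),
      {h | ∃ f ∈ Ex63.poly K z v, ∃ b ∈ Ex63.lifts K δ', h = f ≫ (K.atV v).map b.hom} =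
        {h | ∃ p ∈ (DStrip.model K).signedPolyAut (fun _ => (FlPM.mk (l := l) 0 δ).right),
          ∃ g ∈ Ex63.poly K (FlPM.mk (l := l) 0 δ • z) v, h = (p v).hom ≫ g} := by
    rcases FlPM.isPositive_or_isNegative (FlPM.mk (l := l) 0 δ) with h | h
    · exact ⟨FlPM.mk 0 δ, fun z v => Ex63.equivariant_of_isPositive h z v⟩
    · exact ⟨FlPM.mk 0 δ * FlPM.transl (-d), fun z v => Ex63.twEquivariant_of_twistedNegCompat htw h z v⟩
  obtain ⟨b, hb⟩ := Ex63.lifts_nonempty (K := K) δ'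
  obtain ⟨s, hs⟩ := DStrip.exists_mem_signedPolyAut (DStrip.model K) (fun _ => (FlPM.mk (l := l) 0 δ).right)
  -- transported coordinates
  let αT₁ : ∀ t : H₁.T, (DStrip.model K).Iso (H₁.capsule t) := fun t v =>
    α₁ (ι₁.symm t) v ≪≫ eqToIso (congrArg (fun s => (H₁.capsule s).obj v) (ι₁.apply_symm_apply t))
  have hαT₁ : ∀ z, αT₁ (ι₁ z) = α₁ z := fun z =>
    DStrip.isoCast_eq (fun s => H₁.capsule (ι₁ s)) _ α₁ (ι₁.symm_apply_apply z)
  let αT₂ : ∀ t : H₂.T, (DStrip.model K).Iso (H₂.capsule t) := fun t v =>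
    α₂ (ι₂.symm t) v ≪≫ eqToIso (congrArg (fun s => (H₂.capsule s).obj v) (ι₂.apply_symm_apply t))
  have hαT₂ : ∀ z, αT₂ (ι₂ z) = α₂ z := fun z =>
    DStrip.isoCast_eq (fun s => H₂.capsule (ι₂ s)) _ α₂ (ι₂.symm_apply_apply z)
  have hPM₁' : ∀ t, H₁.polyPM t = DStrip.plusFullPolyIso ((αT₁ t).symm.trans β₁) := by
    intro t; obtain ⟨z, rfl⟩ := ι₁.surjective t
    rw [hαT₁, hPM₁ z, Ex62.poly_eq, DStrip.polyConj_plusFullPolyIso]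
    congr 1; funext v
    change ((α₁ z v).symm ≪≫ CategoryTheory.Iso.refl _) ≪≫ β₁ v = (α₁ z v).symm ≪≫ β₁ v; simp
  have hPM₂' : ∀ t, H₂.polyPM t = DStrip.plusFullPolyIso ((αT₂ t).symm.trans β₂) := by
    intro t; obtain ⟨z, rfl⟩ := ι₂.surjective t
    rw [hαT₂, hPM₂ z, Ex62.poly_eq, DStrip.polyConj_plusFullPolyIso]
    congr 1; funext v
    change ((α₂ z v).symm ≪≫ CategoryTheory.Iso.refl _) ≪≫ β₂ v = (α₂ z v).symm ≪≫ β₂ v; simp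
  -- the common index bijection and the `Θ^±`-codomain isomorphism `‡β ∘ s ∘ †β⁻¹`
  let κ : H₁.T ≃ H₂.T := ι₁.symm.trans ((FlPM.toPerm l (FlPM.mk 0 δ)).trans ι₂)
  let ψ : H₁.codomain.Iso H₂.codomain := (β₁.symm.trans s).trans β₂
  -- the `Θ^±`-part
  let pm : DThetaPMBridge.Iso H₁.pmBridge H₂.pmBridge :=
    { indexEquiv := κ
      indexEquiv_charts := hκ
      capsPoly := fun t => DStrip.plusFullPolyIso (((αT₁ t).symm.trans s).trans (αT₂ (κ t)))
      capsPoly_plusFull := fun t => ⟨_, rfl⟩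
      codPoly := DStrip.plusFullPolyIso ψ
      codPoly_plusFull := ⟨_, rfl⟩
      compat := fun t => by
        change DStrip.polyComp (DStrip.plusFullPolyIso _) (H₂.polyPM (κ t)) =
          DStrip.polyComp (H₁.polyPM t) (DStrip.plusFullPolyIso ψ)
        rw [hPM₂', hPM₁', DStrip.polyComp_plusFullPolyIso, DStrip.polyComp_plusFullPolyIso]
        congr 1
        funext v
        change (((αT₁ t v).symm ≪≫ s v) ≪≫ αT₂ (κ t) v) ≪≫ ((αT₂ (κ t) v).symm ≪≫ β₂ v) =
          ((αT₁ t v).symm ≪≫ β₁ v) ≪≫ (((β₁ v).symm ≪≫ s v) ≪≫ β₂ v)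
        simp }
  -- the `Θ^{ell}`-part
  let ell : DThetaEllBridge.Iso H₁.ellBridge H₂.ellBridge :=
    { indexEquiv := κ
      indexEquiv_charts := fun e he => by
        change ι₁.symm.trans (((FlPM.toPerm l (FlPM.mk 0 δ)).trans ι₂).trans e) ∈ H₁.grpT.toTorsor.charts
        rw [Equiv.trans_assoc]
        refine H₁.grpT.toTorsor.symm_trans_mem_of_compat (indexEquiv_torsor_charts H₁.grpT ι₁ hι₁) ?_
        obtain ⟨g, hg⟩ := indexEquiv_torsor_charts H₂.grpT ι₂ hι₂ e he
        refine ⟨g * FlPM.mk 0 δ, ?_⟩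
        show FlPM.toPerm l (g * FlPM.mk 0 δ) = (FlPM.toPerm l (FlPM.mk 0 δ)).trans (ι₂.trans e)
        rw [map_mul, Equiv.Perm.mul_def, show FlPM.toPerm l g = ι₂.trans e from hg]
      capsPoly := fun t => DStrip.plusFullPolyIso (((αT₁ t).symm.trans s).trans (αT₂ (κ t)))
      capsPoly_plusFull := fun t => ⟨_, rfl⟩
      globPoly := {χ | ∃ c' ∈ K.autCsp H₂.glob, χ = (γ₁.symm ≪≫ b ≪≫ γ₂) ≪≫ c'}
      globPoly_orbit := ⟨_, rfl⟩
      compat := fun t v => by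
        obtain ⟨z, rfl⟩ := ι₁.surjective t
        change {h | ∃ p ∈ DStrip.plusFullPolyIso (((αT₁ (ι₁ z)).symm.trans s).trans
            (αT₂ (ι₂ ((FlPM.mk 0 δ : FlPM l) • ι₁.symm (ι₁ z))))),
            ∃ g ∈ H₂.polyEll (ι₂ ((FlPM.mk 0 δ : FlPM l) • ι₁.symm (ι₁ z))) v, h = (p v).hom ≫ g} =
          {h | ∃ f ∈ H₁.polyEll (ι₁ z) v,
            ∃ q ∈ {χ : H₁.glob ≅ H₂.glob | ∃ c' ∈ K.autCsp H₂.glob, χ = (γ₁.symm ≪≫ b ≪≫ γ₂) ≪≫ c'},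
              h = f ≫ (K.atV v).map (q : H₁.glob ≅ H₂.glob).hom}
        have hs' : ((αT₁ (ι₁ z)).symm.trans s).trans (αT₂ (ι₂ ((FlPM.mk 0 δ : FlPM l) • ι₁.symm (ι₁ z)))) =
            (s.symm.trans (α₁ z)).symm.trans (α₂ ((FlPM.mk 0 δ : FlPM l) • ι₁.symm (ι₁ z))) := by
          rw [hαT₁, hαT₂]; rfl
        rw [hs', hEll₂, hEll₁, ellConj_capsule_side,
          ellConj_global_side_of_twEquivariant (α₁ z) γ₁ γ₂ z v (hE z v) hb hs, Equiv.symm_apply_apply] }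
  refine ⟨⟨pm, ell, fun t => rfl, fun t p => ?_⟩, rfl⟩
  -- same capsule poly-isomorphism
  change p ∈ DStrip.plusFullPolyIso (((αT₁ t).symm.trans s).trans (αT₂ (κ t))) ↔
    (fun v => p v ≪≫ eqToIso rfl) ∈ DStrip.plusFullPolyIso (((αT₁ t).symm.trans s).trans (αT₂ (κ t)))
  simp only [eqToIso_refl, Iso.trans_refl]

/-- **[IUTchI] Prop 6.6 (iii) — PROVED from the TWISTED `[−1]`-compatibility of `φ^{Θell}_{•,v}`** (p. 165:
"the set of isomorphisms between two `𝒟-Θ^{±ell}`-Hodge theaters forms a `{±1}`-torsor … maps bijectively … to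
the set of isomorphisms of `𝔽_l^±`-groups between the index sets"): if for ONE `d ∈ 𝔽_l` every `φ^{Θell}_{•,v}`
intertwines some negative automorphism of `𝒟_v` with a lift of `(d, −1)`, then `DThetaPMEllHT.IsoTorsor H₁ H₂`
holds for all `𝒟-Θ^{±ell}`-Hodge theaters; existence and injectivity are unconditional (abc-iut-w5-d199 /
abc-iut-L5-t13).  `d = 0` is abc-iut-L5-t13's `isoTorsor_of_negCompat`. [claim: Mochizuki2012, status: disputed] -/
theorem isoTorsor_of_twistedNegCompat {d : ZMod l}
    (htw : ∀ v, ∃ a : K.model v ≅ K.model v, K.labMap v a = labNeg (K.isLocal_model v) ∧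
      ∃ b ∈ Ex63.lifts K (FlPM.mk d (-1)), a.hom ≫ K.phiEll v = K.phiEll v ≫ (K.atV v).map b.hom)
    (H₁ H₂ : K.DThetaPMEllHT) : IsoTorsor H₁ H₂ := fun hV =>
  ⟨isoTorsor_nonempty H₁ H₂, isoTorsor_injective hV H₁ H₂, isoTorsor_surjective_of_twistedNegCompat htw H₁ H₂⟩

end DThetaPMEllHT

end PMBaseKit

end Literature.IUT.HodgeTheaters
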